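import Literature.NumberTheory.EllipticCurves.MazurTateElementOdd
import Literature.NumberTheory.EllipticCurves.QuadraticTwist
import Literature.NumberTheory.EllipticCurves.Rank1Residual.Typed.Basic
import Literature.NumberTheory.EllipticCurves.RealPeriod
import Literature.NumberTheory.EllipticCurves.ComplexPeriod
import Literature.NumberTheory.EllipticCurves.Isogeny
import HarnessLib

/-!
# Cell `bsd-f1-sign2` (`p = 2`, non-CM) — analytic lens (seat `-an`), candidate AN-3: the ODD BRANCH at `2`
# — the minus twisted symbol sum `[1/4]⁻ − [3/4]⁻ = θ⁻_0(0)` at `ψ = χ₋₄` carries `BSD₂` of the ADDITIVE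
# twists by `d ∈ {−1, −2}` of a curve good supersingular at `2` (`OddBranchValueAtChi4R` value law,
# leaf slice `AdditiveOddBranchAtTwo`, archimedean transports `TwistPeriodAtMinusOneSS` / `…MinusTwoSS`)

HONEST FRAMING (typer seat `bsd-f1-sign2-ty`; HOME `run/shared/lean/pub/bsd-f1-sign2/`, CANDIDATES.md §2
row AN-3): STATEMENTS ONLY — four `@[conjecture] def`s (OPEN obligations of ours: the value law
`OddBranchValueAtChi4R` = REF1's k-free member-free repair C′, THEOREM-GRADE / IN PRINT per REF2 (tree
`ratMinusTwistedSymbolSum_mul_minusPeriod_mul_I` + newform-of-twist identification); the leaf slice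
`AdditiveOddBranchAtTwo` (68 `χ₋₄` + 6 `χ₋₈` X5 classes; OPEN); supports `TwistPeriodAtMinusOneSS`,
`TwistPeriodAtMinusTwoSS` (Tate's algorithm at `2` + the tree's `realPeriod_mul_realPeriod_quadraticTwist_mul_sqrt`))
and ONE proved cross-link to the typer's odd-branch carrier (`oddBranchValueAtChi4R_iff_mazurTateElementOdd`:
the law's left side is `θ⁻_0(0) = (mazurTateElementOdd f 2 0).eval 0`, `eval_zero_mazurTateElementOdd_two_zero`);
nothing asserted, nothing booked, no named fact, PARTITION: none moved. Source: `HOME/MEMO-an-data/Sketch.lean`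
v2 sha16 59844b141506c32a (planner bsd-f1-sign2-an g1, rc 0), bodies re-filed VERBATIM (namespace moved to
the cell's `…Rank1Residual.F1Sign2`). REFUTER PASS: REF1 §2 KILLED the v1 `OddBranchValueAtChi4`
(`∃ k ≤ 3 ∀ W … Ω(Wm)`: the member period varies by odd factors inside an isogeny class, class 75a →
1200r1/1200r2) and PRESCRIBED the k-free C′ re-filed here verbatim; REF2 v2 §0: repaired value law IN
PRINT/tree, leaf slice OPEN. REF1-AUDIT-v1.md §8.2 (batch 2, 2026-08-27T15:06Z, file sha16 e1bf27aeee759c96): every v2 decl of this file **SURVIVES** (11/11 -an v2 closed Props A1 rc 0, BC7 LIBRARY-SEARCH-ON CLEAN; typing suggestions non-blocking, recorded in CANDIDATES.md §2). REF2 on the v2 rows: pending at filing.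

BC5 WITNESS (ENGINE D2 j280798 → D2-RESULT-v1 §1b/§5, -an join MEMO-an-data/dan_d2_join.json): with
`Ω⁻(W′)` := generator of the anti-invariant period lattice (= `|Im ω₂|` if `Δ > 0`, `2|Im ω₂|` if `Δ < 0`)
the k-free law `θ₀⁻(χ₋₄)·Ω⁻(W′) = −2·L(W′ ⊗ χ₋₄, 1)` holds on ALL **53/53** non-vanishing rows (39 `Δ<0` +
14 `Δ>0`); `θ₁⁻(χ₋₈)·Ω⁻ = −√8·L(W′⊗χ₋₈,1)` 19/19; `θ = 0 ⟺ L(twist) = 0` on 65/65 × 3 (tree sign: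
`[r]_tree = −x/c_∞`). MEMBER TRANSPORT: `2·Ω(W^{(−1)}_min) = n(W)·Ω⁻(W)` 42/42 (`n = 1` on the 32 `Δ<0`
rows, `2` on the 10 `Δ>0`), `√2·Ω(W^{(−2)}_min) = n(W)·Ω⁻(W)` 6/6; hence `v₂θ₀⁻(χ₋₄) = v₂q(Wm) + v₂ n(W)`
(32 + 10 rows exactly) and `v₂θ₁⁻(χ₋₈) = v₂q + v₂n + 1` (4 + 2). CHEAPEST FALSIFIER: a D-an-2 row with
`v₂([1/4]⁻ − [3/4]⁻) ≠ 1 + v₂(L(Wm,1)/Ω⁻_f)` → 0/53 (NOT KILLED). WHY NOVEL: the leaf slice (BSD₂ of the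
`χ₋₄`/`χ₋₈`-twists of non-CM good-ss-at-2 curves) is not in print (REF2 MAP §5); cross-link: the law's left
side is the `T = 0` term of IMC-A's `ω`-odd branch (`constantCoeff_padicLFunctionMinusBranch_one_two`).

References: [MazurTateTeitelbaum1986Invent] §I.8 (8.6) (odd-character Birch lemma); [Pal2012] Prop. 2.5;
HOME MEMO-an.md v1.2, MEMO-an-data/Sketch.lean 59844b141506c32a, REF1-AUDIT-v1.md §2, REF2-PLACEMENT-v2.md §3.
-/

set_option autoImplicit false

noncomputable section

open scoped Classical MatrixGroups ModularForm

open CongruenceSubgroup Polynomial WeierstrassCurve Literature.NumberTheory.EllipticCurves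
  Literature.NumberTheory.EllipticCurves.ModularForms Literature.NumberTheory.EllipticCurves.Rank1Residual

namespace Summit.BirchSwinnertonDyer.Rank1Residual.F1Sign2

/-- **AN-3 value law `OddBranchValueAtChi4R` at `ψ = χ₋₄` (REPAIRED per REF1 §2 = REF1's k-free, member-free
C′ verbatim; THEOREM-GRADE / IN PRINT per REF2** via the tree's odd-character Birch formula
`ratMinusTwistedSymbolSum_mul_minusPeriod_mul_I` (`τ(χ₋₄) = 2i`) plus the newform-of-twist identification
`L(f ⊗ χ₋₄, s) = L(Wm, s)`): `([1/4]⁻_f − [3/4]⁻_f) · Ω⁻_f = 2 · L(Wm, 1)` for `W` good at `2` with newform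
`f` and `Wm` a globally minimal model of `W ⊗ χ₋₄`. Support for AN-3′. Witness 53/53 (all non-vanishing
D-an-2 rows). [cite: MazurTateTeitelbaum1986Invent, §I.8 (8.6) (Birch's lemma for odd characters; the twist bookkeeping is ours)] -/
@[conjecture] def OddBranchValueAtChi4R : Prop :=
  ∀ {N : ℕ} [NeZero N] (f : CuspForm (Gamma0 N) 2) (W : WeierstrassCurve ℚ) [W.IsElliptic] [W.IsGloballyMinimal]
    (Wm : WeierstrassCurve ℚ) [Wm.IsElliptic] [Wm.IsGloballyMinimal],
    IsNewformOf W f → W.HasGoodReductionAtPrime 2 →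
    (∃ C : WeierstrassCurve.VariableChange ℚ, C • W.quadraticTwist (-1) = Wm) →
    (((ratMinusSymbol f (1/4) - ratMinusSymbol f (3/4) : ℚ) : ℂ)) * (minusPeriod f : ℂ) =
      2 * Wm.entireLFunction 1

/-- **AN-3′ `AdditiveOddBranchAtTwo` (the odd-branch sub-crux: 68 `χ₋₄` + 6 `χ₋₈` X5 classes; REF2: leaf
slice OPEN):** `BSD(W_d, 2)` for the non-CM analytic-rank-0 curves additive at `2` that are the twist by
`d ∈ {−1, −2}` of a curve good supersingular at `2`. [folklore] -/
@[conjecture] def AdditiveOddBranchAtTwo : Prop :=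
  ∀ (d : ℚ), d = -1 ∨ d = -2 →
  ∀ (Wd : WeierstrassCurve ℚ) [Wd.IsElliptic] [Wd.IsGloballyMinimal],
    ¬ Wd.HasCM → Wd.analyticRank = 0 → Addv Wd 2 →
    (∃ (W : WeierstrassCurve ℚ) (_ : W.IsElliptic) (_ : W.IsGloballyMinimal)
        (C : WeierstrassCurve.VariableChange ℚ), GoodSS W 2 ∧ C • W.quadraticTwist d = Wd) →
    BSDp Wd 2

/-- **AN-3t `TwistPeriodAtMinusOneSS` (support; the door's ARCHIMEDEAN TRANSPORT on the odd branch):** for `W`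
good supersingular at `2` (so `a₃` is odd and the naive `(−1)`-twist model is scaled by `u = ½` to become
minimal at `2`) and `Wm` a globally minimal model of `W ⊗ χ₋₄`: `2 · Ω(W) · Ω(Wm) = n(W) · ∫_{E(ℂ)}|ω ∧ ω̄|`,
i.e. `2 Ω(Wm) = n(W) · Ω⁻(W)` (42/42 rows: `n = 1` on the 32 with `Δ < 0`, `n = 2` on the 10 with
`Δ > 0`). Instance of the tree theorem `realPeriod_mul_realPeriod_quadraticTwist_mul_sqrt` (naive model,
`D = −1`) + minimal-model scaling at `2`; it turns the f-only law `OddBranchValueAtChi4R` into member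
bookkeeping `v₂θ₀⁻(χ₋₄) = v₂(L(Wm,1)/Ω(Wm)) + v₂ n(W)` (32 + 10 rows exactly). Support-grade (Tate's
algorithm at `2`). [cite: Pal2012, Prop. 2.5 (period of a quadratic twist; the 2-minimality bookkeeping is ours)] -/
@[conjecture] def TwistPeriodAtMinusOneSS : Prop :=
  ∀ (W : WeierstrassCurve ℚ) [W.IsElliptic] [W.IsGloballyMinimal]
    (Wm : WeierstrassCurve ℚ) [Wm.IsElliptic] [Wm.IsGloballyMinimal],
    GoodSS W 2 →
    (∃ C : WeierstrassCurve.VariableChange ℚ, C • W.quadraticTwist (-1) = Wm) →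
    2 * W.realPeriodRat * Wm.realPeriodRat =
      (W.baseChange ℝ).numRealComponents * ((W.baseChange ℝ).map (algebraMap ℝ ℂ)).complexPeriod

/-- **AN-3t′ `TwistPeriodAtMinusTwoSS` (support; the `χ₋₈` companion, 6/6 rows: `√2 · Ω(Wm) = n(W) · Ω⁻(W)`;
the naive `(−2)`-twist of a GoodSS curve is already minimal at `2`):** `√2 · Ω(W) · Ω(Wm) = n(W) · ∫_{E(ℂ)}|ω ∧ ω̄|`
for `Wm` a globally minimal model of `W ⊗ χ₋₈`; bookkeeping `v₂θ₁⁻(χ₋₈) = v₂(L(Wm,1)/Ω(Wm)) + v₂ n(W) + 1`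
(4 + 2 rows). [cite: Pal2012, Prop. 2.5 (period of a quadratic twist; the 2-minimality bookkeeping is ours)] -/
@[conjecture] def TwistPeriodAtMinusTwoSS : Prop :=
  ∀ (W : WeierstrassCurve ℚ) [W.IsElliptic] [W.IsGloballyMinimal]
    (Wm : WeierstrassCurve ℚ) [Wm.IsElliptic] [Wm.IsGloballyMinimal],
    GoodSS W 2 →
    (∃ C : WeierstrassCurve.VariableChange ℚ, C • W.quadraticTwist (-2) = Wm) →
    Real.sqrt 2 * W.realPeriodRat * Wm.realPeriodRat =
      (W.baseChange ℝ).numRealComponents * ((W.baseChange ℝ).map (algebraMap ℝ ℂ)).complexPeriod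

/-! ## Cross-link to the odd-branch carrier (proved) -/

/-- **The left side of `OddBranchValueAtChi4R` is the level-`0` ODD-BRANCH Mazur–Tate element at `2`
evaluated at the trivial wild character:** `[1/4]⁻_f − [3/4]⁻_f = θ⁻_0(f)(0)`
(`Literature…eval_zero_mazurTateElementOdd_two_zero`, `θ⁻_0 = mazurTateElementOdd f 2 0`, the `ω = χ₋₄`
branch of level `4`), so the law reads `θ⁻_0(0) · Ω⁻_f = 2·L(Wm, 1)` — the statement D2 tested as
«`θ₀⁻(χ₋₄)·Ω⁻ = −2·L(E^{(−4)},1)`» in PARI's sign convention. [cite: MazurTateTeitelbaum1986Invent, §I.8 and §I.13] -/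
theorem oddBranchValueAtChi4R_iff_mazurTateElementOdd :
    OddBranchValueAtChi4R ↔
      ∀ {N : ℕ} [NeZero N] (f : CuspForm (Gamma0 N) 2) (W : WeierstrassCurve ℚ) [W.IsElliptic]
        [W.IsGloballyMinimal] (Wm : WeierstrassCurve ℚ) [Wm.IsElliptic] [Wm.IsGloballyMinimal],
        IsNewformOf W f → W.HasGoodReductionAtPrime 2 →
        (∃ C : WeierstrassCurve.VariableChange ℚ, C • W.quadraticTwist (-1) = Wm) →
        ((((mazurTateElementOdd f 2 0).eval 0 : ℚ) : ℂ)) * (minusPeriod f : ℂ) =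
          2 * Wm.entireLFunction 1 := by
  unfold OddBranchValueAtChi4R
  simp only [eval_zero_mazurTateElementOdd_two_zero]

end Summit.BirchSwinnertonDyer.Rank1Residual.F1Sign2

end
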